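import Literature.Algebra.Lie.LefschetzModule
import Literature.Algebra.Lie.WeylCompleteReducibility
import HarnessLib

/-!
# The invariants of a Lefschetz module: a vector of degree `0` killed by `𝔞` is killed by all of `𝔤(𝔞, M)`
# (Looijenga–Lunts 1997, §1 (1.3) and the proof of (1.6))

[topic Algebra/Lie]

Topic `Literature/Algebra/Lie` (namespace `Literature.Algebra.Lie`).  Lane `lit-hodgefound` (Track 2 foundations
library), skeleton seat `lit-hodgefound-skel-1` (generation 45), row **A1-143** of
`run/shared/lean/pub/lit-hodgefound/SKELETON.md`.  THEOREMS ONLY (no definition, no named fact, no instance, no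
notation; D-0026 net debt `0`).

THE POINT.  Looijenga–Lunts use twice the following weight argument: in a Lefschetz module, anything of degree `0` that
is killed by the `e_a` is killed by the partners `f_a`, hence by the whole Lie algebra `𝔤(𝔞, M)` — in (1.3) ("the
Jacobson–Morozov lemma implies that `f_a` also preserves `φ` infinitesimally") and in the proof of (1.6) ("if we regard
`φ` as an element of `M^* ⊗ M^*` of degree zero, then the fact that `φ` is killed by `e_a` implies that it is killed by
`f_a`").  Row A1-97 (`LefschetzModuleInvariantForm.lean`) formalised the instance they need (bilinear forms).  This file
records the principle itself, for a vector of ANY finite-dimensional Lie module `V` of ANY Lie algebra `L` with a marked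
`h` and a subspace `𝔞` (characteristic `0`): `⁅h, v⁆ = 0` and `⁅a, v⁆ = 0` for all `a ∈ 𝔞` imply `⁅x, v⁆ = 0` for every
`x ∈ 𝔤(h, 𝔞)` — so the `𝔤(𝔞, M)`-invariants of a Lefschetz module are exactly its `𝔞`-invariants of degree `0`
(Mathlib's `LieModule.maxTrivSubmodule`).  The `𝔰𝔩₂`-step "weight `0` and killed by `e` ⟹ killed by `f`" is Mathlib's
`IsSl2Triple.HasPrimitiveVectorWith.pow_toEnd_f_eq_zero_of_eq_nat` (Bourbaki VIII §1 no. 2).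

## Sources, VERBATIM (held text `paper:arxiv-alg-geom_9604014`, page/line numbers of that text)

> (§1 (1.3), p0005 L6–L8) "If `a` is a Lefschetz element, then the Jacobson–Morozov lemma implies that `f_a` also
> preserves `φ` infinitesimally. So `𝔤(𝔞, M)` is then a subalgebra of `aut(M, φ)`."
> (§1 (1.6), proof, p0005 L92–L94) "If we regard `φ` as an element of `M^* ⊗ M^*` of degree zero, then the fact that
> `φ` is killed by `e_a` implies that it is killed by `f_a`. So `𝔤(𝔞, M)` preserves `φ` infinitesimally."

## What is formalised

* §1 (any Lie algebra `L`, any finite-dimensional Lie module `V`, characteristic `0`)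
  **`lie_eq_zero_of_isSl2Triple_of_lie_eq_zero`** (`⁅e, v⁆ = 0 = ⁅h, v⁆ ⟹ ⁅f, v⁆ = 0` for an `𝔰𝔩₂`-triple `(e, h, f)`),
  **`lie_eq_zero_of_mem_lefschetzLieAlgebra_of_forall_lie_eq_zero`** (`⁅h, v⁆ = 0`, `⁅𝔞, v⁆ = 0 ⟹ ⁅𝔤(h, 𝔞), v⁆ = 0`;
  the generators by hypothesis and §1, and the annihilator of `v` is closed under brackets),
  **`mem_maxTrivSubmodule_lefschetzLieAlgebra_iff`** (for `(h, 𝔞)` with a non-empty Lefschetz domain: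
  `V^{𝔤(h, 𝔞)} = {v | ⁅h, v⁆ = 0, ⁅𝔞, v⁆ = 0}`).
* §2 (`L = 𝔤𝔩(M)`, `V = M`) `apply_eq_zero_of_mem_lefschetzLieAlgebra` (`h m = 0`, `e_a m = 0 ⟹ x m = 0` on `𝔤(𝔞, M)`),
  **`IsLefschetzModule.mem_maxTrivSubmodule_iff`** and **`IsLefschetzModule.coe_maxTrivSubmodule_eq`**
  (`M^{𝔤(𝔞, M)} = M_0 ∩ ⋂_{a ∈ 𝔞} ker e_a`) for a Lefschetz module `(𝔞, M)`.
* §3 (rider) **`IsLefschetzModule.isCompl_maxTrivSubmodule_lie_top`** (`M = M^{𝔤(𝔞, M)} ⊕ 𝔤(𝔞, M)·M`, H. Weyl's theorem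
  of the tree, `WeylCompleteReducibility.lean`, for the semisimple `𝔤(𝔞, M)`) and `IsLefschetzModule.degreeSpace_le_lie_top`
  (`M_k ⊆ 𝔤(𝔞, M)·M` for `k ≠ 0`).

## SCOPE

The bilinear-form instance is A1-97 (`isSkewAdjoint_of_isSl2Triple'`, `lieInvariant_lefschetzLieAlgebra`); morphisms
of Lefschetz `𝔞`-modules (the instance `V = Hom(M', M'')`) are `LefschetzModuleDiagonal.lean` §5.  Not formalised: the
finer isotypic decomposition of `𝔤(𝔞, M)·M`.

## References

* [LooijengaLunts1997] E. Looijenga, V. A. Lunts, *A Lie algebra attached to a projective variety*, Invent. Math. 129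
  (1997) 361–412; arXiv:alg-geom/9604014. §1 (1.3) p. 5 L6–L8; (1.6) proof p. 5 L92–L94 (held
  `paper:arxiv-alg-geom_9604014`).
* [Bourbaki2008LieGroups79] N. Bourbaki, *Lie Groups and Lie Algebras, Chapters 7–9*, Ch. VIII §1 no. 2 (primitive
  elements), as packaged in Mathlib's `IsSl2Triple.HasPrimitiveVectorWith`.
* [Bourbaki1989LieGroups13] N. Bourbaki, *Lie Groups and Lie Algebras, Chapters 1–3*, Ch. I §6 no. 2 Thm. 2 (H. Weyl),
  no. 9 (the component in `N₀`) — the tree's `WeylCompleteReducibility.lean`.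
-/

namespace Literature.Algebra.Lie

open Module Function Set LieModule

-- The commutator Lie ring of `𝔤𝔩(M) = Module.End K M`: Mathlib's reducible NON-instance `LieRing.ofAssociativeRing`,
-- enabled file-locally exactly as in `LefschetzModule.lean` and every file of the series.
attribute [local instance 100] LieRing.ofAssociativeRing

/-! ### §1 The weight argument in a general Lie module -/

section General

/-- **"Killed by `e_a` implies killed by `f_a`" in degree `0`**: for an `𝔰𝔩₂`-triple `(e, h, f)` of `L` and a vector `v`
of a finite-dimensional `L`-module over a field `K` of characteristic `0` (an explicit argument: it does not occur in the
conclusion) with `⁅e, v⁆ = 0` and `⁅h, v⁆ = 0`, also `⁅f, v⁆ = 0` — a non-zero such `v` is a primitive vector of weight `0`,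
whose string `v, f v, …` stops at once (Mathlib `IsSl2Triple.HasPrimitiveVectorWith.pow_toEnd_f_eq_zero_of_eq_nat`).
[cite: LooijengaLunts1997, §1 (1.6) proof p0005 L92–L94, (1.3) p0005 L6–L8] [cite: Bourbaki2008LieGroups79, Ch. VIII §1 no. 2] -/
theorem lie_eq_zero_of_isSl2Triple_of_lie_eq_zero (K : Type*) [Field K] [CharZero K] {L : Type*} [LieRing L]
    [LieAlgebra K L] {V : Type*} [AddCommGroup V] [Module K V] [FiniteDimensional K V] [LieRingModule L V]
    [LieModule K L V] {h e f : L} (t : IsSl2Triple h e f) {v : V} (he : ⁅e, v⁆ = 0) (hh : ⁅h, v⁆ = 0) :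
    ⁅f, v⁆ = 0 := by
  by_cases hv : v = 0
  · rw [hv, lie_zero]
  have P : t.HasPrimitiveVectorWith v (0 : K) := ⟨hv, by rw [hh, zero_smul], he⟩
  have h1 := P.pow_toEnd_f_eq_zero_of_eq_nat (n := 0) (by rw [Nat.cast_zero])
  rwa [zero_add, pow_one, LieModule.toEnd_apply_apply] at h1

variable {K : Type*} [Field K] [CharZero K] {L : Type*} [LieRing L] [LieAlgebra K L]
  {V : Type*} [AddCommGroup V] [Module K V] [FiniteDimensional K V] [LieRingModule L V] [LieModule K L V]
  {h : L} {𝔞 : Submodule K L}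

/-- **The `𝔞`-invariants of degree `0` are `𝔤(h, 𝔞)`-invariants**: if `⁅h, v⁆ = 0` and `⁅a, v⁆ = 0` for all `a ∈ 𝔞`,
then `⁅x, v⁆ = 0` for every `x` of the Lie subalgebra `𝔤(h, 𝔞)` generated by `𝔞` and the partners of its Lefschetz
elements (the generators `a ∈ 𝔞` by hypothesis, the partners `f_a` by `lie_eq_zero_of_isSl2Triple_of_lie_eq_zero`, and the
annihilator of `v` is closed under brackets: `⁅⁅x, y⁆, v⁆ = ⁅x, ⁅y, v⁆⁆ - ⁅y, ⁅x, v⁆⁆`).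
[cite: LooijengaLunts1997, §1 (1.6) proof p0005 L92–L94 ("killed by e_a implies … killed by f_a. So 𝔤(𝔞, M) preserves φ"), (1.3) p0005 L6–L8] -/
theorem lie_eq_zero_of_mem_lefschetzLieAlgebra_of_forall_lie_eq_zero {v : V} (hh : ⁅h, v⁆ = 0)
    (h𝔞 : ∀ a ∈ 𝔞, ⁅a, v⁆ = 0) {x : L} (hx : x ∈ lefschetzLieAlgebra K h 𝔞) : ⁅x, v⁆ = 0 := by
  rw [lefschetzLieAlgebra] at hx
  induction hx using LieSubalgebra.lieSpan_induction with
  | mem x hx =>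
    rcases hx with hx | hx
    · exact h𝔞 x hx
    · obtain ⟨a, ha, t⟩ := mem_lefschetzDuals_iff.1 hx
      exact lie_eq_zero_of_isSl2Triple_of_lie_eq_zero K t (h𝔞 a ha) hh
  | zero => exact zero_lie v
  | add x y _ _ hx hy => rw [add_lie, hx, hy, add_zero]
  | smul c x _ hx => rw [smul_lie, hx, smul_zero]
  | lie x y _ _ hx hy => rw [lie_lie, hx, hy, lie_zero, lie_zero, sub_zero]

/-- **`V^{𝔤(h, 𝔞)} = {v | ⁅h, v⁆ = 0 and ⁅𝔞, v⁆ = 0}`** as soon as some element of `𝔞` is Lefschetz (so that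
`h = [e_a, f_a] ∈ 𝔤(h, 𝔞)`): the invariants of the Lie subalgebra `𝔤(h, 𝔞) ≤ L` acting on `V` (Mathlib
`LieModule.maxTrivSubmodule`) are the `𝔞`-invariants of `h`-degree `0`.
[cite: LooijengaLunts1997, §1 (1.6) proof p0005 L92–L94, (1.3) p0005 L6–L8] -/
theorem mem_maxTrivSubmodule_lefschetzLieAlgebra_iff (hne : (lefschetzDomain K h 𝔞).Nonempty) {v : V} :
    v ∈ maxTrivSubmodule K (lefschetzLieAlgebra K h 𝔞) V ↔ ⁅h, v⁆ = 0 ∧ ∀ a ∈ 𝔞, ⁅a, v⁆ = 0 := by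
  rw [mem_maxTrivSubmodule]
  constructor
  · intro hv
    obtain ⟨e, he, f, t⟩ := hne
    refine ⟨?_, fun a ha ↦ ?_⟩
    · have h1 := hv ⟨h, h_mem_lefschetzLieAlgebra_of_isSl2Triple he t⟩
      rwa [LieSubalgebra.coe_bracket_of_module] at h1
    · have h1 := hv ⟨a, mem_lefschetzLieAlgebra_of_mem ha⟩
      rwa [LieSubalgebra.coe_bracket_of_module] at h1
  · rintro ⟨hh, h𝔞⟩ ⟨x, hx⟩
    rw [LieSubalgebra.coe_bracket_of_module]
    exact lie_eq_zero_of_mem_lefschetzLieAlgebra_of_forall_lie_eq_zero hh h𝔞 hx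

end General

/-! ### §2 The case `L = 𝔤𝔩(M)`, `V = M`: the invariants of a Lefschetz module -/

section Module

variable {K : Type*} [Field K] [CharZero K] {M : Type*} [AddCommGroup M] [Module K M] [FiniteDimensional K M]
  {h : Module.End K M} {𝔞 : Submodule K (Module.End K M)}

/-- **A vector of degree `0` killed by every `e_a` is killed by every `x ∈ 𝔤(𝔞, M)`** (`h m = 0` and `e_a m = 0` for
all `a ∈ 𝔞` imply `x m = 0`; no Lefschetz hypothesis on `(𝔞, M)` is needed — only the Lefschetz elements of `𝔞` contribute
partners). [cite: LooijengaLunts1997, §1 (1.6) proof p0005 L92–L94, (1.3) p0005 L6–L8] -/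
theorem apply_eq_zero_of_mem_lefschetzLieAlgebra {m : M} (hh : h m = 0) (h𝔞 : ∀ a ∈ 𝔞, a m = 0)
    {x : Module.End K M} (hx : x ∈ lefschetzLieAlgebra K h 𝔞) : x m = 0 := by
  have h1 := lie_eq_zero_of_mem_lefschetzLieAlgebra_of_forall_lie_eq_zero (V := M) (h := h) (𝔞 := 𝔞) (v := m)
    (by rw [Module.End.lie_apply, hh]) (fun a ha ↦ by rw [Module.End.lie_apply, h𝔞 a ha]) hx
  rwa [Module.End.lie_apply] at h1

/-- **The invariants of a Lefschetz module: `m ∈ M^{𝔤(𝔞, M)} ↔ h m = 0 ∧ ∀ a ∈ 𝔞, e_a m = 0`.**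
[cite: LooijengaLunts1997, §1 (1.6) proof p0005 L92–L94, (1.3) p0005 L6–L8] -/
theorem IsLefschetzModule.mem_maxTrivSubmodule_iff (A : IsLefschetzModule K h 𝔞) {m : M} :
    m ∈ maxTrivSubmodule K (lefschetzLieAlgebra K h 𝔞) M ↔ h m = 0 ∧ ∀ a ∈ 𝔞, a m = 0 := by
  rw [mem_maxTrivSubmodule_lefschetzLieAlgebra_iff A.nonempty_lefschetzDomain]
  simp only [Module.End.lie_apply]

/-- … as subspaces: **`M^{𝔤(𝔞, M)} = M_0 ∩ ⋂_{a ∈ 𝔞} ker e_a`** (the invariants are the `𝔞`-invariant vectors of degree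
`0`). [cite: LooijengaLunts1997, §1 (1.6) proof p0005 L92–L94, (1.3) p0005 L6–L8] -/
theorem IsLefschetzModule.coe_maxTrivSubmodule_eq (A : IsLefschetzModule K h 𝔞) :
    ((maxTrivSubmodule K (lefschetzLieAlgebra K h 𝔞) M : LieSubmodule K (lefschetzLieAlgebra K h 𝔞) M) :
        Submodule K M) = degreeSpace h 0 ⊓ ⨅ a ∈ 𝔞, LinearMap.ker a := by
  ext m
  rw [LieSubmodule.mem_toSubmodule, A.mem_maxTrivSubmodule_iff, Submodule.mem_inf, mem_degreeSpace_iff,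
    Int.cast_zero, zero_smul, Submodule.mem_iInf]
  simp only [Submodule.mem_iInf, LinearMap.mem_ker]

/-- In particular the invariants sit in degree `0`: `M^{𝔤(𝔞, M)} ⊆ M_0`. [cite: LooijengaLunts1997, §1 (1.6) proof p0005 L92–L94] -/
theorem IsLefschetzModule.maxTrivSubmodule_le_degreeSpace_zero (A : IsLefschetzModule K h 𝔞) :
    ((maxTrivSubmodule K (lefschetzLieAlgebra K h 𝔞) M : LieSubmodule K (lefschetzLieAlgebra K h 𝔞) M) :
        Submodule K M) ≤ degreeSpace h 0 := by
  rw [A.coe_maxTrivSubmodule_eq]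
  exact inf_le_left

end Module

/-! ### §3 `M = M^{𝔤(𝔞, M)} ⊕ 𝔤(𝔞, M)·M` (Weyl) and the invariants as the degree-`0` vectors outside `𝔤(𝔞, M)·M` -/

section Decomposition

variable {K : Type*} [Field K] [CharZero K] {M : Type*} [AddCommGroup M] [Module K M] [FiniteDimensional K M]
  {h : Module.End K M} {𝔞 : Submodule K (Module.End K M)}

/-- **`M = M^{𝔤(𝔞, M)} ⊕ 𝔤(𝔞, M)·M`** for a Lefschetz module: `𝔤(𝔞, M)` is semisimple and `M` finite-dimensional
(characteristic `0`), so the invariants — the `𝔞`-invariant vectors of degree `0`, §2 — and `𝔤(𝔞, M)·M` are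
supplementary `𝔤(𝔞, M)`-submodules (H. Weyl's theorem, the tree's `isCompl_maxTrivSubmodule_lie_top`).
[cite: LooijengaLunts1997, §1 (1.1) p0004 L56–L58 ("(𝔞, M) is a Lefschetz module if 𝔤(𝔞, M) is semisimple"), (1.6) proof p0005 L92–L94] [cite: Bourbaki1989LieGroups13, Ch. I §6 no. 2 Thm. 2 (p0108), no. 9 (p0122)] -/
theorem IsLefschetzModule.isCompl_maxTrivSubmodule_lie_top (A : IsLefschetzModule K h 𝔞) :
    IsCompl (maxTrivSubmodule K (lefschetzLieAlgebra K h 𝔞) M)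
      ⁅(⊤ : LieIdeal K (lefschetzLieAlgebra K h 𝔞)), (⊤ : LieSubmodule K (lefschetzLieAlgebra K h 𝔞) M)⁆ := by
  haveI := A.isSemisimple
  haveI : FiniteDimensional K (lefschetzLieAlgebra K h 𝔞) :=
    inferInstanceAs (FiniteDimensional K (lefschetzLieAlgebra K h 𝔞).toSubmodule)
  exact Literature.Algebra.Lie.isCompl_maxTrivSubmodule_lie_top

omit [FiniteDimensional K M] in
/-- **Every degree `k ≠ 0` lies in `𝔤(𝔞, M)·M`** (`m = k⁻¹ h m` with `h ∈ 𝔤(𝔞, M)`), so the complement `𝔤(𝔞, M)·M` of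
the invariants contains `⊕_{k ≠ 0} M_k` and the decomposition `M = M^{𝔤(𝔞, M)} ⊕ 𝔤(𝔞, M)·M` is non-trivial only in
degree `0` (cf. `maxTrivSubmodule_le_degreeSpace_zero`).
[cite: LooijengaLunts1997, §1 (1.1) p0004 L56–L57 ("the grading is induced from the action of ad_h"), (1.6) proof p0005 L92–L94] -/
theorem IsLefschetzModule.degreeSpace_le_lie_top (A : IsLefschetzModule K h 𝔞) {k : ℤ} (hk : k ≠ 0) :
    degreeSpace h k ≤ ((⁅(⊤ : LieIdeal K (lefschetzLieAlgebra K h 𝔞)), (⊤ : LieSubmodule K (lefschetzLieAlgebra K h 𝔞) M)⁆ :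
      LieSubmodule K (lefschetzLieAlgebra K h 𝔞) M) : Submodule K M) := by
  intro m hm
  rw [mem_degreeSpace_iff] at hm
  have hk' : ((k : K)) ≠ 0 := Int.cast_ne_zero.2 hk
  have h1 : ⁅((⟨h, A.h_mem⟩ : lefschetzLieAlgebra K h 𝔞) : lefschetzLieAlgebra K h 𝔞), m⁆ ∈
      ⁅(⊤ : LieIdeal K (lefschetzLieAlgebra K h 𝔞)), (⊤ : LieSubmodule K (lefschetzLieAlgebra K h 𝔞) M)⁆ :=
    LieSubmodule.lie_mem_lie (LieSubmodule.mem_top _) (LieSubmodule.mem_top m)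
  rw [LieSubalgebra.coe_bracket_of_module, Module.End.lie_apply, hm] at h1
  have h2 := Submodule.smul_mem _ ((k : K)⁻¹) h1
  rw [smul_smul, inv_mul_cancel₀ hk', one_smul] at h2
  exact h2

end Decomposition

end Literature.Algebra.Lie
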